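import Summits.QuantumFields.BalabanUV.T4Continuum.Support.ShellMeasureLandauEndAssembledDecayCfLinCoTestsSchurCoarseV6
import Summits.QuantumFields.BalabanUV.T4Continuum.Support.ShellMeasureReadOutsMax

/-!
# `T4Continuum.ShellMeasureLandauEndAssembledDecayCfLinCoTestsSchurCoarseV6ReadOuts`
# — ROW S109 f2′ = THE v6 TOP (R-ne7cp1-g37-1 (c4); option (B) of R-ne7cp1-g37-5: NO S114 fold, `𝔸` abstract): the u-tuple's
# ABSTRACT carrier `𝒴` READ as the (19)∕(98) source space
# `WMax w w′ (covD Λu η U₀u)` on the block's fine bonds, the classifier letters := the four (Ad-twisted) lattice-angle read-outs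
# of `∂p` — census rows R12∕R13 `hκ hℓ hlen hκc hcurl` DERIVED, `m := 4`, `κr := η∕w₀`, `κc := 2η²∕w₀′²`, the (SM) rows from
# η-FREE numbers; conclusion IDENTICAL to S110′'s
(cell `pub-balaban`, sub-cell `t4`, spine estimate NE7c (node U5b); NE7c ROUND-2 crew, unit
`b2b-balaban-t4-ne7c-formalise-leaf-08` gen 17; owner table `t4/b2b-balaban-t4-ne7c-p1/LEAVES-NE7c-P1.md` **ROW S109 «W-i READ-OUT
ROWS ON THE (19)∕(98) SOURCE SPACE»**, file f2′ = the v6 TOP (RULINGS R-ne7cp1-g36-12 (4), R-ne7cp1-g37-1 (c4), R-ne7cp1-g37-5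
(B), R-ne7cp1-g37-10 (a); f2 = p240165 was the first chain's link (4));
OFFER l.21839, COLLISION NOTE l.22078, f1 `ShellMeasureReadOutsMax` p238765 ✓ XREAD ok leaf-05-g11 C-ne7cL05g11-5); ADDITIVE —
imports the v6 chain's last middle link S110′
`ShellMeasureLandauEndAssembledDecayCfLinCoTestsSchurCoarseV6` (author leaf-03-g9, filed by courier leaf-08-g17; the v6 chain:
ROOT S112 f3 `…RayStokesAssembledDecayV6`
(leaf-07-g10) → leaf-03-g9's eight relinked middle links `…ReachV6 → …ReachBoxV6 → …CfV6 → …CfLinV6 → …CfLinCoTestsV6 → …SchurV6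
→ …SchurElbV6 → …SchurCoarseV6`)
and S109 f1 `ShellMeasureReadOutsMax` ONLY;
[folklore]; ONE theorem, 0 `def`, 0 `def … : Prop`, 0 sorry, 0 citation tags; the statement is GENERATED from S110′'s bytes
(p246871, sha16 0efed3935bffecec) by `HOME/b2b-balaban-t4-ne7c-formalise-leaf-08/g17/gen_f2.py`
— every surviving binder passed to the host BY NAME, the conclusion COPIED VERBATIM)

HONEST FRAMING.  Finite four-torus programme, rung (B)+1 only — NOT infinite volume, NOT a mass gap, NOT the Clay problem,
NOT summit progress; (B), `BetaPertHyp`, (B^μ) not consumed.  NE7c (`T4IndicatorShell.ShellWeightBound`) is NOT PRINTED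
in [Balaban 1983–89] and NOT PROVED; «NE7c ⇐ the named binders» (trigger c3): every binder below is DISPLAYED, asserted by
nobody; (M1) realized ≠ NE7c.  THE OWNER's TWO SENTENCES (R-ne7cp1-g36-12 (4), verbatim): **(i) the u-tuple's remaining W-a
rows `h𝒢 hW hH₁ hH hι` are from now on DISPLAYED IN PRINT's (19)-NORM on the block — `max{|A|·(Lʲη), |∇^η_{U₀}A|·(Lʲη)²}`
([Balaban1985Variational] p. 281 (19), S65 f2c `WMax`) — a SHARPENING OF THE READING, class T unchanged; this is
where [Balaban1985BackgroundPropagators] Thm 3.13 ∕ B11 Prop. 4 would have to be proved; (ii) NOTHING of B11 (19)–(37) is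
discharged — the letters are OUR maps, their norms are arithmetic in OUR instance.**  Equation numbers LOCATE displayed shapes,
they are not citations.  HONEST DEPENDENCY (cell): continuum YM on T⁴ ⇐ BetaPertH ∧ nine spine estimates (0/9 proved);
BetaPertH ⇐ (D1) ∧ (D4) ∧ CAP+tail; G-an2-4 gates asym, D1 and NE2/3/4.

WHAT IS PROVED ([folklore]).
**`slotAC_realized_su2_landauChart_assembled_decay_v6_cfB7_lin_coTests_schur_elb_coarse_readOuts`**
= S110′'s `slotAC_realized_su2_landauChart_assembled_decay_v6_cfB7_lin_coTests_schur_elb_coarse`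
(namespace `ShellMeasureLandauEndAssembledDecayCfLinCoTestsSchurCoarseV6`) BY NAME with:
* THE CARRIER READ: the host's implicit complete normed space `𝒴` := `ShellMeasureReadOutsMax.Ysp Λu η U₀u wu wu′` — S65 f2c's
  `WMax (𝔄 := M_n(ℂ)) (𝔅 := M_n(ℂ)) wu wu′ (covD Λu η U₀u)` on the block's FINE bond set `Λu : Finset (Site P.d × Fin P.d)` with
  the forward covariant-difference datum at a `U1`-valued background `U₀u` (flat `1` in the designed reading of the LOCALIZED
  u-tuple, kept general) and positive weights `wu wu′` with floors `w₀ w₀′` — the space in which (19) norms `A = (1∕iη) log U¹`;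
  `η` = the slot's fine scale (the host's own `η`, bound before its first use); completeness = S109 f1 `instCompleteSpaceYsp`;
* THE LETTERS: `ℓs p := plaqReadOuts Λu η U₀u wu wu′ (plq p).1 (plq p).2.1 (plq p).2.2` for a placement
  `plq : ι → Site × Fin × Fin` of the classifier's plaquettes — [Balaban1985Variational] p. 283 (34)'s four η-SCALED letters of
  `∂p`, two of them `R(U₀)`-transported, up to the contour's base point (a cyclic rotation; immaterial here — sum and norms are
  order-free; leaf-05-g11 F-2);
* LEAVING (DERIVED in S109 f1, census R12∕R13, W-i): `ℓs` (data, DEFINED), `κr` (:= `η∕w₀`), `hκ`,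
  **`hℓ`** (`hℓ_plaqReadOuts_matrix`), `m` (:= `4`), **`hlen`**, `κc` (:= `2η²∕w₀′²`), `hκc`, **`hcurl`**
(`hcurl_plaqReadOuts_matrix`
  — the Stokes identity + the `∇`-half of the max norm), and the (SM) rows `hs₁ ha hma` in their `κ`-form (`smRows_of_etaFree`);
* ENTERING: `Λu U₀u hU₀u wu wu′` + the two weight-positivity instances + floors `w₀ w₀′ hw₀ hw₀′ hfl hfl′` ([S]∕[N]∕[R] — the
  (19) weights `Lʲη`-TYPE, a READING like R01's `m₀`), `plq` ([S]), and the (SM) rows in η-FREE form `hη1 : η ≤ 1`,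
  `hs₁′ : 2X ≤ c₁·w₀′²·z`, `ha′ : X ≤ c₂·w₀·z`, `hma′ : 4X ≤ w₀` ([N];
  `X = ((ε₄ + B₀·2dLC₁ε₁) + B₀·4C2cov·(ε₄ + B₀·2dLC₁ε₁)²)` the host's Landau amplitude — ROW S95's LIFT RULE:
  `κr_j = η_j∕w₀`, `κc_j = 2η_j²∕w₀′²` are level profiles BY CONSTRUCTION, the numbers level-free);
* UNCHANGED: every other binder of S110′ — in particular the u-tuple's W-a rows `𝒢 W𝒱 h𝒢 hW H₁ hH₁ ιs hι Hop hH` and its real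
  structure `L 𝓡𝒵 𝓡ℬ h𝒢r hWr hιr hHr hH₁r hTr`, now TYPED ON THE DESIGNED CARRIER (sentence (i)); `hsm` keeps its shape with
  `m = 4`; `hudict` reads `holOf (plaqReadOuts …)` (node O's sentence, class O unchanged; its letters' side is one `rw` from the
  (1.22) word identity — leaf-05-g11 F-1, not here); the w-∕e-tuples, (T2)∕(T3)∕(S78), the γ3 readings, links (1)–(3)'s Schur ∕
  `hElb₁` ∕ coarse-geometry junctions, the v6 root's field-size budgets (S112) and the 𝓔-leg on the w-tuple's dress (S113) —
VERBATIM; conclusion `SlotAntiConcentration …` IDENTICAL (copied from the tree bytes).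
CENSUS EFFECT (the owner's two engines decide, on S115 = THE ONE CALL v6 over this END): as at v5, T −5 (R12's `hκ hℓ hlen`,
R13's `hκc hcurl`) relative to a top without S109 — v6's total per R-ne7cp1-g37-1 (R12's `hκ hℓ hlen`,
R13's `hκc hcurl`), N∕S∕R + the entering rows.  NOT HERE: any discharge of (19)–(37) or of [5] Thms 3.12∕3.13; the w-tuple's
weight read-outs (R15a); the ONE CALL re-fire (leaf-09 lineage).  NOTHING in the countdown moves; NE7c NOT PROVED; spine PROVED 0∕9.
-/

noncomputable section

open Set Metric NormedSpace MeasureTheory Function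

namespace Summit.QuantumFields.BalabanUV.T4Continuum.ShellMeasureLandauEndAssembledDecayCfLinCoTestsSchurCoarseV6ReadOuts

open scoped ENNReal
open Literature.MathematicalPhysics.QuantumFieldTheory.Balaban1983to89
open B11Prop6Scheme (Prop4Hyp)
open GaugeField (GaugeInvariant)
open T4ShellMeasure (SlotAntiConcentration)
open T4CubePoincare (cube)
open T4CubeChartGnomonic (SU2)
open T4CubeChartExp (expFibreChart)
open T4TreeGaugeFixing (NoClosedLoop fixTo noClosedLoop_combBonds)
open T4ShellMeasurePlaquette (expTail₂)
open ShellMeasureLevelAssembly (classifier)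
open ShellMeasureMultiGridNorms (WSup)
open ShellMeasurePinnedNorm (pinW kerOpPin pinDist pinDist_le_add)
open ShellMeasureMultiGridNorms.WSup (toPiL)
open ShellMeasureLandauHolonomy (solAt landauExp)
open ShellMeasureLandauHolonomyChart (holOf cplx)
open ShellMeasureLandauHolonomySkew (readOutReal)
open ShellMeasureRayTermsPinnedLandauW (hE_landau_chartRay_pinned_w)
open ShellMeasureRayLogIntegral (rayBound_of_logIntegral rayBound_add)
open ShellMeasureLandauEndFinal (slotAC_realized_su2_landauChart_final)
open ShellMeasureLandauEndRayStokesAssembled (wilsonProfile_nonneg)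
open ShellMeasureDecayKernelSums (kerOp)
open ShellMeasureLandauWilsonSquaresKernelsSchwarzField (hE_landau_wilsonSquares_located_schwarz_of_decay_field)
open ShellMeasureRayTermsPinnedLandau (hE_landau_chartRay_pinned completeSpace_wsup)
open ShellMeasureLandauEndWindowRestrictRel (slotAC_realized_su2_landauChart_final_of_reach')
open T4AxialGaugeSmallField (boxPlaqs boxBonds)
open T4AxialGaugeFixing (combBonds)
open ShellMeasureWindowReachCollar (hreach'_of_core_collar)
open ShellMeasureLandauEndWindowReach (reach_family_inhabited)
open ShellMeasureLevelZeroBoxWitness (toyParams blockBonds boxPlaqF)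
open ShellMeasureLandauEndAssembledDecayReachV6 (slotAC_realized_su2_landauChart_assembled_decay_v6_of_reach')
open B7Prop2Explicit (C0 c2' unitaryUnits avgClosed_unitaryUnits)
open B7Prop1Local (pdevOn loK bondHiK)
open B7Prop5Flat (BondIn)
open ShellMeasureAverageProp4General (C1cov O1cov C2cov C1cov_pos)
open ShellMeasureLandauCorrectionB7 (landauCf landauRad)
open ShellMeasureLandauCorrectionReal (skewPi isClosed_skewPi)
open ShellMeasureLandauCfBoxLocal (landauCfBox landauCfBox_local landauCfBox_real_binders_local)
open ShellMeasureLandauCorrectionB7Local (landauCorrection_real_binders_flat landauCorrection_binders_local)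
open ShellMeasureAverageLocality148 (landauCf_congr)
open ShellMeasureLandauCfPinned (conj_binders_of_local C2cov_nonneg)
open ShellMeasureLandauEndAssembledDecayReachBoxV6 (slotAC_realized_su2_landauChart_assembled_decay_v6_of_core_collar)
open ShellMeasureLinearChartMap (hΦd_of_linear hΦ0_of_linear hΦ_of_linear hΦr_of_linear)
open ShellMeasureLandauEndAssembledDecayCfV6 (slotAC_realized_su2_landauChart_assembled_decay_v6_cfB7)
open ShellMeasureCoTestStarShaped (jco_triple_of_neighbours)
open ShellMeasureLandauEndAssembledDecayCfLinV6 (slotAC_realized_su2_landauChart_assembled_decay_v6_cfB7_lin)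
open ShellMeasureDecayKernelSchur (norm_kerOp_le_of_decay_junction_family)
open ShellMeasureLandauEndAssembledDecayCfLinCoTestsV6 (slotAC_realized_su2_landauChart_assembled_decay_v6_cfB7_lin_coTests)
open ShellMeasureRayTermsPinnedLower (hElb_landau_chartRay_pinned_linear)
open ShellMeasureLandauEndAssembledDecayCfLinCoTestsSchurV6
  (slotAC_realized_su2_landauChart_assembled_decay_v6_cfB7_lin_coTests_schur)
open ShellMeasureLiveEndLevelBlindRows (rowSum_coarse_le)
open TreeLengthTorus (TPt)
open B12Decay510Torus (pl1 pl1_nonneg)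
open ShellMeasureLandauEndAssembledDecayCfLinCoTestsSchurElbV6
  (slotAC_realized_su2_landauChart_assembled_decay_v6_cfB7_lin_coTests_schur_elb)
open ShellMeasureLandauEndAssembledDecayCfLinCoTestsSchurCoarseV6
  (slotAC_realized_su2_landauChart_assembled_decay_v6_cfB7_lin_coTests_schur_elb_coarse)
open ShellMeasureCommutatorCovDatum (covIdx covD)
open ShellMeasureLandauCfPinned (C2cov_nonneg)
open B7Prop1Explicit (U1)
open ShellMeasureReadOutsMax (Ysp rdOut plaqReadOuts hℓ_plaqReadOuts_matrix hlen_plaqReadOuts hcurl_plaqReadOuts_matrix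
  readOut_constants_nonneg smRows_of_etaFree)

section Box

open scoped Matrix.Norms.L2Operator

variable {P : Params} {j : ℕ} [DecidableEq (PBond P j)]
variable {n : Type*} [Fintype n] [DecidableEq n] [Nonempty n]
variable {𝒵 ℬ : Type*} [NormedAddCommGroup 𝒵] [NormedSpace ℂ 𝒵] [NormedAddCommGroup ℬ] [NormedSpace ℂ ℬ]
variable {𝔸 : Type*} [CStarAlgebra 𝔸] [Nontrivial 𝔸]


/-- **THE v6 TOP: THE MOST-ASSEMBLED ONE-SLOT END OF THE LAST CHAIN WITH THE u-TUPLE's CARRIER READ AS THE (19)∕(98) SOURCE SPACE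
AND ITS READ-OUT ROWS DERIVED (v6 TOP)** — S110′
`slotAC_realized_su2_landauChart_assembled_decay_v6_cfB7_lin_coTests_schur_elb_coarse`
BY NAME with `𝒴 := Ysp Λu η U₀u wu wu′`, `ℓs := plaqReadOuts …`, `κr := η∕w₀`, `m := 4`, `κc := 2η²∕w₀′²` (S109 f1), the (SM)
rows from the η-free `hs₁′ ha′ hma′`; every other binder and the
conclusion VERBATIM (module docstring: LEAVING∕ENTERING, the owner's sentences (i)(ii)).  CONDITIONAL on every displayed
binder; readings NOT asserted; NOT Bałaban's minimiser (node O); nothing of (19)–(37) discharged; NE7c NOT PROVED. [folklore] -/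
theorem slotAC_realized_su2_landauChart_assembled_decay_v6_cfB7_lin_coTests_schur_elb_coarse_readOuts
    {lo hi : Fin P.d → ℤ} {nb : ℕ} (hn : ∀ κ, hi κ ≤ lo κ + nb) (hN : ∀ κ, hi κ - lo κ < P.sitesPerDir j)
    (Λ : Finset (PBond P j)) (hΛbox : ∀ b ∈ Λ, b ∈ boxBonds lo hi) (hΛcomb : Disjoint Λ (combBonds lo hi)) {m₀ : ℕ}
    (e : ↥Λ × Fin 3 ≃ Fin m₀) {S : ℝ} (hS : 0 < S) (hSπ : 3 * S ^ 2 < Real.pi ^ 2) {F : GaugeField P j SU2 → ℝ≥0∞}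
    (hF : Measurable F) (hFi : GaugeInvariant F) {u : GaugeField P j SU2 → ℝ} (hu : Measurable u) (hui : GaugeInvariant u)
    {ι : Type*} {Pu : Finset ι} (hPu : Pu.Nonempty)
    -- the classifier's plaquettes PLACED on the fine lattice: `plq p = (x, μ, ν)` ⇒ `ℓs p :=` the four (Ad-twisted) lattice-angle
    -- read-outs of `∂p` (S109 f1 `plaqReadOuts`; [Balaban1985Variational] (34)'s letters) — R12∕R13 `hκ hℓ hlen hκc hcurl` DERIVED
    (plq : ι → B7Prop1Explicit.Site P.d × Fin P.d × Fin P.d) {κN : Type*} (N : Finset κN) {ιN : κN → Type*}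
    {PuN : (i : κN) → Finset (ιN i)} (hPuN : ∀ i, (PuN i).Nonempty) {AN : Type*} [NormedRing AN] [NormedAlgebra ℂ AN]
    [CompleteSpace AN] (holN : (i : κN) → GaugeField P j SU2 → ιN i → (Fin m₀ → ℝ) → AN) {θN RN HN δN : κN → ℝ}
    (hRN : ∀ i ∈ N, 1 < RN i) (hθN : ∀ i ∈ N, 0 < θN i) (hδ0N : ∀ i ∈ N, 0 ≤ δN i) (hδ1N : ∀ i ∈ N, δN i ≤ 1)
    (hSMN : ∀ i ∈ N, 36 * HN i * 1 ^ 2 / (RN i - 1) ^ 2 ≤ δN i * θN i)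
    (hANN : ∀ i ∈ N, ∀ V, ∀ x ∈ closedBall (0 : Fin m₀ → ℝ) S, ∀ p ∈ PuN i, ∃ f : ℂ → AN, DifferentiableOn ℂ f (ball 0 (RN i)) ∧
      (∀ w ∈ ball (0 : ℂ) (RN i), ‖f w‖ ≤ HN i) ∧ f 0 = 0 ∧ ∀ c : ℝ, 0 ≤ c → c ≤ 1 → f (c : ℂ) = holN i V p (c • x) - 1)
    {δ ρ β : ℝ}
    -- ══ ROW S109 (R-ne7cp1-g36-12 (4)): the u-tuple's carrier READ as the (19)∕(98) source space on the block's
    -- fine bond set `Λu` with the `∇^η_{U₀u}`-datum (S65 f2c∕f5b, S109 f1 `Ysp`), weights `wu wu′` with floors; `η` = the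
    -- slot's fine scale (bound here, before its first use; the host binds it with `εθ c₁ c₂ z`) ══
    {η : ℝ} (Λu : Finset (B7Prop1Explicit.Site P.d × Fin P.d))
    (U₀u : B7Prop1Explicit.Site P.d → Fin P.d → (Matrix n n ℂ)ˣ) (hU₀u : ∀ y κ, U₀u y κ ∈ U1 (Matrix n n ℂ))
    (wu : ↥Λu → ℝ) (wu' : ↥(covIdx Λu) → ℝ) [Fact (∀ b, 0 < wu b)] [Fact (∀ i, 0 < wu' i)]
    {w₀ w₀' : ℝ} (hw₀ : 0 < w₀) (hw₀' : 0 < w₀') (hfl : ∀ b, w₀ ≤ wu b) (hfl' : ∀ i, w₀' ≤ wu' i)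
    (𝒢 : GaugeField P j SU2 → (𝒵 →L[ℂ] (Ysp Λu η U₀u wu wu'))) (W𝒱 : GaugeField P j SU2 → (Ysp Λu η U₀u wu wu') → 𝒵)
    {B₀ C₄ a₃ ε₄ : ℝ} (h𝒢 : ∀ V f, ‖𝒢 V f‖ ≤ B₀ * ‖f‖) (hW : ∀ V, Prop4Hyp (W𝒱 V) C₄ a₃) (hB₀ : 0 < B₀) (hC₄ : 0 ≤ C₄)
    (hε₄ : 0 ≤ ε₄) {dL C₁ B₃ ε₁ : ℝ} (hdL : 0 ≤ dL) (hC₁ : 0 ≤ C₁) (hε₁ : 0 ≤ ε₁) (hB₃ : dL ≤ B₃)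
    (h1 : 2 * B₀ * C₁ * B₃ * ε₁ ≤ ε₄) (h2 : 4 * ε₄ ≤ a₃) (h3 : 16 * B₀ * C₄ * ε₄ ≤ 1)
    (H₁ : GaugeField P j SU2 → (ℬ →L[ℂ] (Ysp Λu η U₀u wu wu'))) (hH₁ : ∀ V B, ‖H₁ V B‖ ≤ B₀ * ‖B‖)
    (T : GaugeField P j SU2 → ((Fin m₀ → ℂ) →L[ℂ] ℬ)) {rΦ : ℝ} (hTb : ∀ V, ‖T V‖ * rΦ < 2 * dL * C₁ * ε₁) (hSr : S < rΦ) (k : ℕ)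
    (Sf Sf' Sw Sw' : Finset (B7Prop1Explicit.Site P.d × Fin P.d))
    (Ubg : GaugeField P j SU2 → B7Prop1Explicit.Site P.d → Fin P.d → 𝔸ˣ) (hUbg : ∀ V x κ, Ubg V x κ ∈ unitaryUnits 𝔸) {α₀ : ℝ}
    (hα : 0 < α₀) (hα3 : C0 P.d * α₀ ≤ 1 / 3) (hα4 : 4 * α₀ ≤ c2' P.d P.L) (hα6 : 4 * O1cov P.d * α₀ ≤ 1 / 3)
    (h52locw : ∀ V (c : ↥Sw'), pdevOn (loK P.L k c.1.1) (bondHiK P.L k c.1.1 c.1.2) (Ubg V) < α₀ * (((P.L : ℝ) ^ k)⁻¹) ^ 2)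
    (ιs : GaugeField P j SU2 → ((Ysp Λu η U₀u wu wu') →L[ℂ] (↥Sf → 𝔸))) (hι : ∀ V Y, ‖ιs V Y‖ ≤ ‖Y‖)
    (Hop : GaugeField P j SU2 → ((↥Sf' → 𝔸) →L[ℂ] (Ysp Λu η U₀u wu wu'))) (hH : ∀ V X, ‖Hop V X‖ ≤ B₀ * ‖X‖) {ε₃ : ℝ}
    (h18 : 18 * C2cov P.d * B₀ * ε₃ ≤ 1) (hcoup : ε₄ + B₀ * (2 * dL * C₁ * ε₁) ≤ ε₃) (h3R : 3 * ε₃ ≤ landauRad P.d P.L)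
    {Λw Λz Λb : Type*} [Fintype Λw] [DecidableEq Λw] [Fintype Λz] [Fintype Λb] {𝔄w ℭ 𝔇 : Type*} [NormedAddCommGroup 𝔄w]
    [NormedSpace ℂ 𝔄w] [CompleteSpace 𝔄w] [NormedAddCommGroup ℭ] [NormedSpace ℂ ℭ] [NormedAddCommGroup 𝔇] [NormedSpace ℂ 𝔇]
    {δw : ℝ} (hδw : 0 ≤ δw) {Nc : ℕ} [NeZero Nc] (Bref : Finset (TPt P.d Nc)) (hBref : Bref.Nonempty) (pos : Λw → TPt P.d Nc)
    (posz : Λz → TPt P.d Nc) (pos' : ↥Sw → TPt P.d Nc) (posx : ↥Sw' → TPt P.d Nc) (posb : Λb → TPt P.d Nc)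
    {multw multz multx multb : ℕ} (hmultw : ∀ x, (Finset.univ.filter fun b' => pos b' = x).card ≤ multw)
    (hmultz : ∀ x, (Finset.univ.filter fun b' => posz b' = x).card ≤ multz)
    (hmultx : ∀ x, (Finset.univ.filter fun b' => posx b' = x).card ≤ multx)
    (hmultb : ∀ x, (Finset.univ.filter fun b' => posb b' = x).card ≤ multb) (k𝒢 : GaugeField P j SU2 → Λw → Λz → (ℭ →L[ℂ] 𝔄w))
    (kι : GaugeField P j SU2 → ↥Sw → Λw → (𝔄w →L[ℂ] 𝔸)) (kH : GaugeField P j SU2 → Λw → ↥Sw' → (𝔸 →L[ℂ] 𝔄w))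
    (kH₁ : GaugeField P j SU2 → Λw → Λb → (𝔇 →L[ℂ] 𝔄w)) {c𝒢 δ𝒢 M𝒢 cι δι Mι cH δH MH cH₁ δH₁ MH₁ : ℝ} (hc𝒢 : 0 ≤ c𝒢)
    (hk𝒢 : ∀ V c b', ‖k𝒢 V c b'‖ ≤ c𝒢 * Real.exp (-(δ𝒢 * pl1 (pos c - posz b')))) (hgap𝒢 : δw < δ𝒢)
    (hM𝒢c : (multz : ℝ) * (2 * ((P.d : ℝ) + (δ𝒢 - δw)) / (δ𝒢 - δw)) ^ P.d ≤ M𝒢) (hcι : 0 ≤ cι)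
    (hkι : ∀ V c b', ‖kι V c b'‖ ≤ cι * Real.exp (-(δι * pl1 (pos' c - pos b')))) (hgapι : δw < δι)
    (hMιc : (multw : ℝ) * (2 * ((P.d : ℝ) + (δι - δw)) / (δι - δw)) ^ P.d ≤ Mι) (hcH : 0 ≤ cH)
    (hkH : ∀ V c b', ‖kH V c b'‖ ≤ cH * Real.exp (-(δH * pl1 (pos c - posx b')))) (hgapH : δw < δH)
    (hMHc : (multx : ℝ) * (2 * ((P.d : ℝ) + (δH - δw)) / (δH - δw)) ^ P.d ≤ MH) (hcH₁ : 0 ≤ cH₁)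
    (hkH₁ : ∀ V c b', ‖kH₁ V c b'‖ ≤ cH₁ * Real.exp (-(δH₁ * pl1 (pos c - posb b')))) (hgapH₁ : δw < δH₁)
    (hMH₁c : (multb : ℝ) * (2 * ((P.d : ℝ) + (δH₁ - δw)) / (δH₁ - δw)) ^ P.d ≤ MH₁)
    (W𝒱w : GaugeField P j SU2 → (Λw → 𝔄w) → (Λz → ℭ)) {B₀w C₄w a₃w ε₄w bw : ℝ} (hWw : ∀ V, Prop4Hyp (W𝒱w V) C₄w a₃w)
    (hB₀w : 0 < B₀w) (hC₄w : 0 ≤ C₄w) (hε₄w : 0 ≤ ε₄w) (hdomw : 2 * (ε₄w + B₀w * bw) ≤ a₃w)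
    (hselfw : B₀w * C₄w * (ε₄w + B₀w * bw) ^ 2 ≤ ε₄w) (hcontrw : 4 * B₀w * C₄w * (ε₄w + B₀w * bw) < 1)
    (Tw : GaugeField P j SU2 → ((Fin m₀ → ℂ) →L[ℂ] (Λb → 𝔇))) {rΦw : ℝ} (hTbw : ∀ V, ‖Tw V‖ * rΦw < bw) (h2Sw : 2 * S ≤ rΦw)
    (hιw : ∀ V Y, ‖kerOp (kι V) Y‖ ≤ ‖Y‖) (hqw : 9 * C2cov P.d * B₀w * (ε₄w + B₀w * bw) < 1)
    (hRCw : 6 * (ε₄w + B₀w * bw) ≤ landauRad P.d P.L) (NW : Λz → Λw → Prop)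
    (hlocW : ∀ V, ∀ A A' : Λw → 𝔄w, ∀ c', (∀ b', NW c' b' → A b' = A' b') → W𝒱w V A c' = W𝒱w V A' c') {rW : ℝ}
    (hreachW : ∀ c' b', NW c' b' → pinDist Bref hBref (posz c') - rW ≤ pinDist Bref hBref (pos b')) {rC : ℝ}
    (hreachC : ∀ (c' : ↥Sw') (b' : ↥Sw), BondIn (loK P.L k c'.1.1) (bondHiK P.L k c'.1.1 c'.1.2) b'.1.1 b'.1.2 → pinDist Bref
      hBref (posx c') - rC ≤ pinDist Bref hBref (pos' b'))
    (hsupp : ∀ V, ∀ z : Fin m₀ → ℂ, ∀ i, 0 < pinDist Bref hBref (posb i) → Tw V z i = 0)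
    (hqW : c𝒢 * M𝒢 * (4 * C₄w * (ε₄w + B₀w * bw) * Real.exp (δw * rW)) < 1)
    (hk : 12 * C2cov P.d * (ε₄w + B₀w * bw) * Real.exp (δw * rC) * (cι * Mι) * (cH * MH) < 1) {𝔭 : Type*} (Pw : Finset 𝔭)
    (ℓw : 𝔭 → List ((Λw → 𝔄w) →L[ℂ] Matrix n n ℂ)) (suppw : 𝔭 → Finset Λw) (ϖPw : 𝔭 → ℝ)
    (hblindw : ∀ p ∈ Pw, ∀ ℓ ∈ ℓw p, ∀ A A' : Λw → 𝔄w, (∀ b' ∈ suppw p, A b' = A' b') → ℓ A = ℓ A')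
    (hdepthw : ∀ p ∈ Pw, ∀ b' ∈ suppw p, ϖPw p ≤ pinDist Bref hBref (pos b')) (hϖPw : ∀ p ∈ Pw, 0 ≤ ϖPw p) {κwb κcb : ℝ}
    (hκwb : 0 ≤ κwb) (hκcb : 0 ≤ κcb) (hℓwb : ∀ p ∈ Pw, ∀ ℓ ∈ ℓw p, ‖ℓ‖ ≤ κwb) (hcurlw : ∀ p ∈ Pw, ‖(ℓw p).sum‖ ≤ κcb) {mw : ℕ}
    (hlenw : ∀ p ∈ Pw, (ℓw p).length ≤ mw) (𝓡𝒴w : AddSubgroup (Λw → 𝔄w)) (h𝓡𝒴w : IsClosed (𝓡𝒴w : Set (Λw → 𝔄w)))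
    (𝓡𝒵w : AddSubgroup (Λz → ℭ)) (𝓡ℬw : AddSubgroup (Λb → 𝔇)) (h𝒢rw : ∀ V, ∀ f ∈ 𝓡𝒵w, kerOp (k𝒢 V) f ∈ 𝓡𝒴w)
    (hWrw : ∀ V, ∀ Y ∈ 𝓡𝒴w, W𝒱w V Y ∈ 𝓡𝒵w) (hιrw : ∀ V, ∀ Y ∈ 𝓡𝒴w, kerOp (kι V) Y ∈ skewPi ↥Sw)
    (hHrw : ∀ V, ∀ X ∈ skewPi (𝔸 := 𝔸) ↥Sw', kerOp (kH V) X ∈ 𝓡𝒴w) (hH₁rw : ∀ V, ∀ B ∈ 𝓡ℬw, kerOp (kH₁ V) B ∈ 𝓡𝒴w)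
    (hTrw : ∀ V (y : Fin m₀ → ℝ), Tw V (cplx y) ∈ 𝓡ℬw)
    (hskew : ∀ p ∈ Pw, ∀ ℓ ∈ ℓw p, ∀ Y ∈ 𝓡𝒴w, ℓ Y ∈ skewAdjoint (Matrix n n ℂ)) (Bp : GaugeField P j SU2 → 𝔭 → Matrix n n ℂ)
    {d : 𝔭 → ℝ} {dbar : ℝ} (hBu : ∀ V, ∀ p ∈ Pw, Bp V p ∈ unitary (Matrix n n ℂ)) (hBd : ∀ V, ∀ p ∈ Pw, ‖Bp V p - 1‖ ≤ d p)
    (hd : ∀ p ∈ Pw, d p ≤ dbar) (hdbar : 0 ≤ dbar) {Kw : ℝ} (hKw : ∑ p ∈ Pw, Real.exp (-(δw * ϖPw p)) ≤ Kw)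
    (hB𝒢w : c𝒢 * M𝒢 ≤ B₀w) (hBH₁w : cH₁ * MH₁ ≤ B₀w) (hBHw : cH * MH ≤ B₀w) {ε₄e : ℝ} (hε₄e : 0 ≤ ε₄e)
    (hdome : 2 * (ε₄e + B₀w * bw) ≤ a₃w) (hselfe : B₀w * (C₄w * Real.exp (δw * rW)) * (ε₄e + B₀w * bw) ^ 2 ≤ ε₄e)
    (hcontre : 4 * B₀w * (C₄w * Real.exp (δw * rW)) * (ε₄e + B₀w * bw) < 1)
    (hιew : ∀ V, ∀ Y : WSup (pinW δw ((pinDist Bref hBref) ∘ pos)) 1 𝔄w, ‖kerOpPin (kι V) δw ((pinDist Bref hBref) ∘ pos)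
      ((pinDist Bref hBref) ∘ pos') Y‖ ≤ ‖Y‖)
    (hqe : 9 * (C2cov P.d * Real.exp (2 * δw * rC)) * B₀w * (ε₄e + B₀w * bw) < 1)
    (hRCe : 3 * (ε₄e + B₀w * bw) ≤ landauRad P.d P.L) {𝔱 : Type*} (I : Finset 𝔱) {Ef : 𝔱 → (Λw → 𝔄w) → ℂ} {rE : ℝ} {ee : 𝔱 → ℝ}
    (hrE : 0 < rE) (hEd : ∀ i ∈ I, DifferentiableOn ℂ (Ef i) (ball 0 rE))
    (hEb : ∀ i ∈ I, ∀ Z ∈ ball (0 : Λw → 𝔄w) rE, ‖Ef i Z‖ ≤ ee i) (supp : 𝔱 → Finset Λw)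
    (hblind : ∀ i ∈ I, ∀ A₁ A₂ : Λw → 𝔄w, (∀ b' ∈ supp i, A₁ b' = A₂ b') → Ef i A₁ = Ef i A₂) (ϖP : 𝔱 → ℝ)
    (hdepth : ∀ i ∈ I, ∀ b' ∈ supp i, ϖP i ≤ (pinDist Bref hBref) (pos b')) {LK : ℝ}
    (hK : ∑ i ∈ I, 2 * ee i / rE * Real.exp (-(δw * ϖP i)) ≤ LK)
    (hcoupE : ((ε₄e + B₀w * bw) + B₀w * (4 * (C2cov P.d * Real.exp (2 * δw * rC)) * (ε₄e + B₀w * bw) ^ 2)) ≤ rE / 2) {Ω : Type*}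
    [MeasurableSpace Ω] (μ : Measure Ω) {g : Ω → ℝ} (hg : ∀ ω, 0 ≤ g ω) (A : GaugeField P j SU2 → (Fin m₀ → ℝ) → Ω → ℝ) {Bd : ℝ}
    (hint : ∀ V, ∀ x ∈ closedBall (0 : Fin m₀ → ℝ) S, ∀ c : ℝ, 1 / 2 ≤ c → c ≤ 1 → Integrable (fun ω => g ω * Real.exp (A V (c •
      x) ω)) μ)
    (hpos : ∀ V, ∀ x ∈ closedBall (0 : Fin m₀ → ℝ) S, ∀ c : ℝ, 1 / 2 ≤ c → c ≤ 1 → 0 < ∫ ω, g ω * Real.exp (A V (c • x) ω) ∂μ)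
    (hA : ∀ V, ∀ x ∈ closedBall (0 : Fin m₀ → ℝ) S, ∀ c : ℝ, 1 / 2 ≤ c → c ≤ 1 → ∀ ω, A V x ω ≤ A V (c • x) ω + (1 - c) * Bd)
    {BE₂ : ℝ} (hElb₂ : ∀ V (y : Fin m₀ → ℝ), ‖y‖ ≤ S → -BE₂ ≤ (-Real.log (∫ ω, g ω * Real.exp (A V y ω) ∂μ)))
    (L : Set ((Ysp Λu η U₀u wu wu') →L[ℂ] Matrix n n ℂ)) (𝓡𝒵 : AddSubgroup 𝒵) (𝓡ℬ : AddSubgroup ℬ)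
    (h𝒢r : ∀ V, ∀ f ∈ 𝓡𝒵, 𝒢 V f ∈ readOutReal L) (hWr : ∀ V, ∀ Y ∈ readOutReal L, W𝒱 V Y ∈ 𝓡𝒵)
    (hιr : ∀ V, ∀ Y ∈ readOutReal L, ιs V Y ∈ skewPi ↥Sf) (hHr : ∀ V, ∀ X ∈ skewPi (𝔸 := 𝔸) ↥Sf', Hop V X ∈ readOutReal L)
    (hH₁r : ∀ V, ∀ B ∈ 𝓡ℬ, H₁ V B ∈ readOutReal L) (hTr : ∀ V (y : Fin m₀ → ℝ), T V (cplx y) ∈ 𝓡ℬ)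
    (hudict : ∀ V, ∀ x ∈ cube m₀ S, u (fixTo (combBonds lo hi) 1 (updateFinset V Λ (expFibreChart Λ 1 e x))) = classifier hPu
      (fun p => holOf (plaqReadOuts Λu η U₀u wu wu' (plq p).1 (plq p).2.1 (plq p).2.2) (fun y => landauExp ((ball (0 : ↥Sf → 𝔸)
      (landauRad P.d P.L)).indicator (landauCf P.L (1 : B7Prop1Explicit.Site P.d → Fin P.d → 𝔸ˣ) k Sf Sf')) (ιs V) (Hop V) (4 *
      C2cov P.d * (ε₄ + B₀ * (2 * dL * C₁ * ε₁)) ^ 2) (solAt (𝒢 V) 0 (W𝒱 V) ε₄ (0 : 𝒵) (H₁ V (T V (cplx y))) + H₁ V (T V (cplx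
      y))))) x)
    (hRdict : ∀ V, ∀ x ∈ cube m₀ S, F (fixTo (combBonds lo hi) 1 (updateFinset V Λ (expFibreChart Λ 1 e x))) = (closedBall (0 :
      Fin m₀ → ℝ) S ∩ ⋂ i ∈ N, {y | classifier (hPuN i) (holN i V) y < θN i}).indicator (1 : (Fin m₀ → ℝ) → ℝ≥0∞) x *
      ENNReal.ofReal (Real.exp (-((∑ p ∈ Pw, β * (1 - (Matrix.trace (Bp V p * holOf (ℓw p) (fun y => landauExp (landauCfBox P.L
      (Ubg V) k Sw Sw' (landauRad P.d P.L)) (kerOp (kι V)) (kerOp (kH V)) (4 * C2cov P.d * (ε₄w + B₀w * bw) ^ 2) (solAt (kerOp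
      (k𝒢 V)) 0 (W𝒱w V) ε₄w (0 : Λz → ℭ) (kerOp (kH₁ V) (Tw V (cplx y))) + kerOp (kH₁ V) (Tw V (cplx y)))) x)).re / Fintype.card
      n)) + ((∑ i ∈ I, Ef i (WSup.toPiL (pinW δw ((pinDist Bref hBref) ∘ pos)) 1 (landauExp (fun Y : WSup (pinW δw ((pinDist
      Bref hBref) ∘ pos')) 1 𝔸 => ((toPiL (pinW δw ((pinDist Bref hBref) ∘ posx)) 1).symm (landauCfBox P.L (Ubg V) k Sw Sw'
      (landauRad P.d P.L) (toPiL (pinW δw ((pinDist Bref hBref) ∘ pos')) 1 Y)) : WSup (pinW δw ((pinDist Bref hBref) ∘ posx)) 1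
      𝔸)) (kerOpPin (kι V) δw ((pinDist Bref hBref) ∘ pos) ((pinDist Bref hBref) ∘ pos')) (kerOpPin (kH V) δw ((pinDist Bref
      hBref) ∘ posx) ((pinDist Bref hBref) ∘ pos)) (4 * (C2cov P.d * Real.exp (2 * δw * rC)) * (ε₄e + B₀w * bw) ^ 2) (solAt
      (kerOpPin (k𝒢 V) δw ((pinDist Bref hBref) ∘ posz) ((pinDist Bref hBref) ∘ pos)) 0 (fun Y : WSup (pinW δw ((pinDist Bref
      hBref) ∘ pos)) 1 𝔄w => ((toPiL (pinW δw ((pinDist Bref hBref) ∘ posz)) 1).symm (W𝒱w V (toPiL (pinW δw ((pinDist Bref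
      hBref) ∘ pos)) 1 Y)) : WSup (pinW δw ((pinDist Bref hBref) ∘ posz)) 1 ℭ)) ε₄e (0 : WSup (pinW δw ((pinDist Bref hBref) ∘
      posz)) 1 ℭ) (kerOpPin (kH₁ V) δw ((pinDist Bref hBref) ∘ posb) ((pinDist Bref hBref) ∘ pos) ((toPiL (pinW δw ((pinDist
      Bref hBref) ∘ posb)) 1).symm (Tw V (cplx x)))) + kerOpPin (kH₁ V) δw ((pinDist Bref hBref) ∘ posb) ((pinDist Bref hBref) ∘
      pos) ((toPiL (pinW δw ((pinDist Bref hBref) ∘ posb)) 1).symm (Tw V (cplx x))))))).re + (-Real.log (∫ ω, g ω * Real.exp (A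
      V x ω) ∂μ)))))))
    (hδ0 : 0 ≤ δ) (hδ1 : δ < 1) (hρ0 : 0 ≤ ρ) (hρ : ρ ≤ (1 - δ) / 2) (hβ : 0 ≤ β) {εθ c₁ c₂ z : ℝ} (hη : 0 < η) (hεθ : 0 < εθ)
    -- (SM) IN η-FREE NUMBERS (S109 f1 `smRows_of_etaFree`; ROW S95's LIFT RULE): with `κr := η∕w₀`, `κc := 2η²∕w₀′²`, `m := 4`
    -- the host's `hs₁ ha hma` follow at every `0 < η ≤ 1` from these level-free inequalities on the Landau amplitude
    (hη1 : η ≤ 1) (hs₁' : 2 * ((ε₄ + B₀ * (2 * dL * C₁ * ε₁)) + B₀ * (4 * C2cov P.d * (ε₄ + B₀ * (2 * dL * C₁ * ε₁)) ^ 2)) ≤ c₁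
      * w₀' ^ 2 * z)
    (ha' : ((ε₄ + B₀ * (2 * dL * C₁ * ε₁)) + B₀ * (4 * C2cov P.d * (ε₄ + B₀ * (2 * dL * C₁ * ε₁)) ^ 2)) ≤ c₂ * w₀ * z) (hma' : 4
      * ((ε₄ + B₀ * (2 * dL * C₁ * ε₁)) + B₀ * (4 * C2cov P.d * (ε₄ + B₀ * (2 * dL * C₁ * ε₁)) ^ 2)) ≤ w₀)
    (hsm : 36 * (c₁ * z + (4 : ℕ) ^ 2 * c₂ ^ 2 * z ^ 2) / (rΦ / S - 1) ^ 2 ≤ δ * εθ) {a : ℝ} (ha0 : 0 ≤ a)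
    (hrad : ((P.d - 1 : ℕ) : ℝ) * nb * a ≤ 2 * Real.sin (S / 2)) {Pcore Pcollar : Set (Plaq P j)}
    (hcover : boxPlaqs lo hi ⊆ Pcore ∪ Pcollar)
    (hcore : ∀ (V : GaugeField P j SU2) (y : ↥Λ → SU2), u (fixTo (combBonds lo hi) 1 (updateFinset V Λ y)) < εθ * η ^ 2 →
      PlaqSmallOn Pcore a (fixTo (combBonds lo hi) 1 (updateFinset V Λ y)))
    (hcollar : ∀ (V : GaugeField P j SU2) (y : ↥Λ → SU2), F (fixTo (combBonds lo hi) 1 (updateFinset V Λ y)) ≠ 0 → PlaqSmallOn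
      Pcollar a (fixTo (combBonds lo hi) 1 (updateFinset V Λ y))) :
    SlotAntiConcentration ((fieldMeasure P j SU2).withDensity F) u (εθ * η ^ 2) ρ (2 * ((m₀ : ℝ) + (3 * (|β| * ((dbar + 2 * (κcb
      * (cH₁ * MH₁ * bw / ((1 - c𝒢 * M𝒢 * (4 * C₄w * (ε₄w + B₀w * bw) * Real.exp (δw * rW))) * (1 - 12 * C2cov P.d * (ε₄w + B₀w
      * bw) * Real.exp (δw * rC) * (cι * Mι) * (cH * MH)))) + expTail₂ (mw * (κwb * (cH₁ * MH₁ * bw / ((1 - c𝒢 * M𝒢 * (4 * C₄w *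
      (ε₄w + B₀w * bw) * Real.exp (δw * rW))) * (1 - 12 * C2cov P.d * (ε₄w + B₀w * bw) * Real.exp (δw * rC) * (cι * Mι) * (cH *
      MH))))))) / (rΦw / S)) * (2 * (κcb * (cH₁ * MH₁ * bw / ((1 - c𝒢 * M𝒢 * (4 * C₄w * (ε₄w + B₀w * bw) * Real.exp (δw * rW)))
      * (1 - 12 * C2cov P.d * (ε₄w + B₀w * bw) * Real.exp (δw * rC) * (cι * Mι) * (cH * MH)))) + expTail₂ (mw * (κwb * (cH₁ *
      MH₁ * bw / ((1 - c𝒢 * M𝒢 * (4 * C₄w * (ε₄w + B₀w * bw) * Real.exp (δw * rW))) * (1 - 12 * C2cov P.d * (ε₄w + B₀w * bw) *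
      Real.exp (δw * rC) * (cι * Mι) * (cH * MH))))))) / (rΦw / S))) * Kw) + (3 * (LK * (2 * ((ε₄e + B₀w * bw) + B₀w * (4 *
      (C2cov P.d * Real.exp (2 * δw * rC)) * (ε₄e + B₀w * bw) ^ 2)))) / (rΦw / S - 1) + Bd))) / (1 - δ)) := by
  have hC2 : 0 ≤ C2cov P.d := C2cov_nonneg P.d
  have hX : 0 ≤ ((ε₄ + B₀ * (2 * dL * C₁ * ε₁)) + B₀ * (4 * C2cov P.d * (ε₄ + B₀ * (2 * dL * C₁ * ε₁)) ^ 2)) := by positivity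
  have hSM := smRows_of_etaFree (c₁ := c₁) (c₂ := c₂) (zs := z) hη hη1 hw₀ hw₀' hX hs₁' ha' hma'
  exact slotAC_realized_su2_landauChart_assembled_decay_v6_cfB7_lin_coTests_schur_elb_coarse
      (lo := lo) (hi := hi) (nb := nb) (hn := hn) (hN := hN) (Λ := Λ) (hΛbox := hΛbox) (hΛcomb := hΛcomb) (m₀ := m₀) (e := e)
      (S := S) (hS := hS) (hSπ := hSπ) (F := F) (hF := hF) (hFi := hFi) (u := u) (hu := hu) (hui := hui) (ι := ι) (Pu := Pu)
      (hPu := hPu) (κN := κN) (N := N) (ιN := ιN) (PuN := PuN) (hPuN := hPuN) (AN := AN) (holN := holN) (θN := θN) (RN := RN)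
      (HN := HN) (δN := δN) (hRN := hRN) (hθN := hθN) (hδ0N := hδ0N) (hδ1N := hδ1N) (hSMN := hSMN) (hANN := hANN) (δ := δ)
      (ρ := ρ) (β := β) (𝒢 := 𝒢) (W𝒱 := W𝒱) (B₀ := B₀) (C₄ := C₄) (a₃ := a₃) (ε₄ := ε₄) (h𝒢 := h𝒢) (hW := hW) (hB₀ := hB₀)
      (hC₄ := hC₄) (hε₄ := hε₄) (dL := dL) (C₁ := C₁) (B₃ := B₃) (ε₁ := ε₁) (hdL := hdL) (hC₁ := hC₁) (hε₁ := hε₁) (hB₃ := hB₃)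
      (h1 := h1) (h2 := h2) (h3 := h3) (H₁ := H₁) (hH₁ := hH₁) (T := T) (rΦ := rΦ) (hTb := hTb) (hSr := hSr) (k := k) (Sf := Sf)
      (Sf' := Sf') (Sw := Sw) (Sw' := Sw') (Ubg := Ubg) (hUbg := hUbg) (α₀ := α₀) (hα := hα) (hα3 := hα3) (hα4 := hα4)
      (hα6 := hα6) (h52locw := h52locw) (ιs := ιs) (hι := hι) (Hop := Hop) (hH := hH) (ε₃ := ε₃) (h18 := h18) (hcoup := hcoup)
      (h3R := h3R) (Λw := Λw) (Λz := Λz) (Λb := Λb) (𝔄w := 𝔄w) (ℭ := ℭ) (𝔇 := 𝔇) (δw := δw) (hδw := hδw) (Nc := Nc)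
      (Bref := Bref) (hBref := hBref) (pos := pos) (posz := posz) (pos' := pos') (posx := posx) (posb := posb) (multw := multw)
      (multz := multz) (multx := multx) (multb := multb) (hmultw := hmultw) (hmultz := hmultz) (hmultx := hmultx)
      (hmultb := hmultb) (k𝒢 := k𝒢) (kι := kι) (kH := kH) (kH₁ := kH₁) (c𝒢 := c𝒢) (δ𝒢 := δ𝒢) (M𝒢 := M𝒢) (cι := cι) (δι := δι)
      (Mι := Mι) (cH := cH) (δH := δH) (MH := MH) (cH₁ := cH₁) (δH₁ := δH₁) (MH₁ := MH₁) (hc𝒢 := hc𝒢) (hk𝒢 := hk𝒢)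
      (hgap𝒢 := hgap𝒢) (hM𝒢c := hM𝒢c) (hcι := hcι) (hkι := hkι) (hgapι := hgapι) (hMιc := hMιc) (hcH := hcH) (hkH := hkH)
      (hgapH := hgapH) (hMHc := hMHc) (hcH₁ := hcH₁) (hkH₁ := hkH₁) (hgapH₁ := hgapH₁) (hMH₁c := hMH₁c) (W𝒱w := W𝒱w)
      (B₀w := B₀w) (C₄w := C₄w) (a₃w := a₃w) (ε₄w := ε₄w) (bw := bw) (hWw := hWw) (hB₀w := hB₀w) (hC₄w := hC₄w) (hε₄w := hε₄w)
      (hdomw := hdomw) (hselfw := hselfw) (hcontrw := hcontrw) (Tw := Tw) (rΦw := rΦw) (hTbw := hTbw) (h2Sw := h2Sw)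
      (hιw := hιw) (hqw := hqw) (hRCw := hRCw) (NW := NW) (hlocW := hlocW) (rW := rW) (hreachW := hreachW) (rC := rC)
      (hreachC := hreachC) (hsupp := hsupp) (hqW := hqW) (hk := hk) (𝔭 := 𝔭) (Pw := Pw) (ℓw := ℓw) (suppw := suppw) (ϖPw := ϖPw)
      (hblindw := hblindw) (hdepthw := hdepthw) (hϖPw := hϖPw) (κwb := κwb) (κcb := κcb) (hκwb := hκwb) (hκcb := hκcb)
      (hℓwb := hℓwb) (hcurlw := hcurlw) (mw := mw) (hlenw := hlenw) (𝓡𝒴w := 𝓡𝒴w) (h𝓡𝒴w := h𝓡𝒴w) (𝓡𝒵w := 𝓡𝒵w) (𝓡ℬw := 𝓡ℬw)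
      (h𝒢rw := h𝒢rw) (hWrw := hWrw) (hιrw := hιrw) (hHrw := hHrw) (hH₁rw := hH₁rw) (hTrw := hTrw) (hskew := hskew) (Bp := Bp)
      (d := d) (dbar := dbar) (hBu := hBu) (hBd := hBd) (hd := hd) (hdbar := hdbar) (Kw := Kw) (hKw := hKw) (hB𝒢w := hB𝒢w)
      (hBH₁w := hBH₁w) (hBHw := hBHw) (ε₄e := ε₄e) (hε₄e := hε₄e) (hdome := hdome) (hselfe := hselfe) (hcontre := hcontre)
      (hιew := hιew) (hqe := hqe) (hRCe := hRCe) (𝔱 := 𝔱) (I := I) (Ef := Ef) (rE := rE) (ee := ee) (hrE := hrE) (hEd := hEd)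
      (hEb := hEb) (supp := supp) (hblind := hblind) (ϖP := ϖP) (hdepth := hdepth) (LK := LK) (hK := hK) (hcoupE := hcoupE)
      (Ω := Ω) (μ := μ) (g := g) (hg := hg) (A := A) (Bd := Bd) (hint := hint) (hpos := hpos) (hA := hA) (BE₂ := BE₂)
      (hElb₂ := hElb₂) (L := L) (𝓡𝒵 := 𝓡𝒵) (𝓡ℬ := 𝓡ℬ) (h𝒢r := h𝒢r) (hWr := hWr) (hιr := hιr) (hHr := hHr) (hH₁r := hH₁r)
      (hTr := hTr) (hudict := hudict) (hRdict := hRdict) (hδ0 := hδ0) (hδ1 := hδ1) (hρ0 := hρ0) (hρ := hρ) (hβ := hβ) (η := η)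
      (εθ := εθ) (c₁ := c₁) (c₂ := c₂) (z := z) (hη := hη) (hεθ := hεθ) (hsm := hsm) (a := a) (ha0 := ha0) (hrad := hrad)
      (Pcore := Pcore) (Pcollar := Pcollar) (hcover := hcover) (hcore := hcore) (hcollar := hcollar)
      (ℓs := fun p => plaqReadOuts Λu η U₀u wu wu' (plq p).1 (plq p).2.1 (plq p).2.2) (κr := η / w₀)
      (hκ := (readOut_constants_nonneg hη.le hw₀ hw₀').1)
      (hℓ := fun p _ => hℓ_plaqReadOuts_matrix Λu η U₀u wu wu' hη.le hU₀u hw₀ hfl _ _ _) (m := 4)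
      (hlen := fun p _ => hlen_plaqReadOuts Λu η U₀u wu wu' _ _ _) (κc := 2 * η ^ 2 / w₀' ^ 2)
      (hκc := (readOut_constants_nonneg hη.le hw₀ hw₀').2)
      (hcurl := fun p _ => hcurl_plaqReadOuts_matrix Λu η U₀u wu wu' hη hw₀' hfl' _ _ _) (hs₁ := hSM.1) (ha := hSM.2.1)
      (hma := hSM.2.2)

end Box

end Summit.QuantumFields.BalabanUV.T4Continuum.ShellMeasureLandauEndAssembledDecayCfLinCoTestsSchurCoarseV6ReadOuts

end
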